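import Mathlib
import HarnessLib
import Summits.HubbardSuperconductivity.HubbardSuperconductivity.Theorems.KLProgrammePerturbedCountThinConstantsDefs

/-!
# Route `KLProgramme` — the thirty smallness conditions of the THIN anchored count for the closed-form constants, part 1: the bar majorants of
# `M_diag, A_diag, M_Γ, M_anti` and the conditions (14) covering, (15) Cooper range, (16) `κA_E`, (17) fold, (18) diagonal stratum

Cell gate-hubbard-kl, seat p3 g25; located #15 «(X).1-C-DOOR-SLOT», cure (γ) step 1 (pen (R535)(A)).  For EVERY `0 ≤ κ ≤ pcThinKappa B m` and the closed-form
cascade of `KLProgrammePerturbedCountThinConstantsDefs` (`s = pcThinS B m`, `e = pcThinE B m`, `τ = pcThinTau B m`, `λ = pcThinLam B m`, `η₀F = pcThinF B m`), the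
conditions of `countPairs_thin_perturbed` numbered as in `exists_thin_small_constants` follow from p4 g4's uniform/affine majorants
(`pcSE_le_bar`, `pcAE_le_bar`, `pcE4_le_affine`, `pcOdd_le_affine`, `pcEven_le_affine`, `pcDiag_le_affine`) by linear arithmetic:

* §1 `pcMdiag_le_bar` (`≤ 10S̄`), `pcAdiag_le_bar` (`≤ pcAdiagBar`), `pcMG_le_bar` (`≤ pcMGBar`), `pcManti_le_bar` (`≤ (5/2)Ā`);
* §2 `thin_kappa_basic`, **`thin_cover_le`** (14), **`thin_odd_le`** (15), **`thin_kAE_le`** (16), **`thin_even_le`** (17), **`thin_diag_le`** (18).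
Part 2 (`…PerturbedCountThinSmallnessExplicit`) has (19)–(30) and the assembly.  Everything is PROVED; no definitions; nothing about the Hubbard model is asserted.
References: BGM 2006 Lemma 3.1 / App. A2–A3 [cite: BenfattoGiulianiMastropietro2006].
-/

noncomputable section

namespace Summit.HubbardSuperconductivity.HubbardSuperconductivity.Theorems.PerturbedFermiCurve

set_option linter.dupNamespace false -- summit = problem name (single-conjunct summit), D-0017

open Real Set
open Literature.MathematicalPhysics.QuantumLattice Literature.MathematicalPhysics.QuantumLattice.BandSectorCounting

variable {a b : ℝ}

/-! ## §1 Uniform majorants of the remaining moving-curve constants -/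

section Bars

variable (B : BandBounds a b) {κ : ℝ} (hκ0 : 0 ≤ κ) (hκ1 : κ ≤ 1) (hκD : κ ≤ B.Dtmin / 2)
include hκ0 hκ1 hκD

/-- `M_diag(κ) ≤ 10 S̄_E`. -/
theorem pcMdiag_le_bar : 0 ≤ pcMdiag B κ ∧ pcMdiag B κ ≤ 10 * pcSEbar B := by
  obtain ⟨hSE0, hSEb⟩ := pcSE_le_bar B hκ0 hκ1 hκD
  unfold pcMdiag
  refine ⟨by positivity, ?_⟩
  nlinarith

/-- `0 ≤ A_diag(κ,κ) ≤ Ā_diag`. -/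
theorem pcAdiag_le_bar : 0 ≤ pcAdiag B κ κ ∧ pcAdiag B κ κ ≤ pcAdiagBar B := by
  obtain ⟨hSE0, hSEb⟩ := pcSE_le_bar B hκ0 hκ1 hκD
  obtain ⟨hAE0, hAEb⟩ := pcAE_le_bar B hκ0 hκ1 hκD
  have hsq : pcSE B κ ^ 2 ≤ pcSEbar B ^ 2 := pow_le_pow_left₀ hSE0 hSEb 2
  unfold pcAdiag pcAdiagBar
  refine ⟨by positivity, ?_⟩
  nlinarith [sq_nonneg (pcSE B κ)]

/-- `0 ≤ M_Γ(κ,κ) ≤ M̄_Γ`. -/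
theorem pcMG_le_bar : 0 ≤ pcMG B κ κ ∧ pcMG B κ κ ≤ pcMGBar B := by
  obtain ⟨hSE0, hSEb⟩ := pcSE_le_bar B hκ0 hκ1 hκD
  obtain ⟨hAE0, hAEb⟩ := pcAE_le_bar B hκ0 hκ1 hκD
  have hsq : pcSE B κ ^ 2 ≤ pcSEbar B ^ 2 := pow_le_pow_left₀ hSE0 hSEb 2
  unfold pcMG pcMGBar
  refine ⟨by positivity, ?_⟩
  nlinarith [sq_nonneg (pcSE B κ)]

/-- `0 ≤ M_anti(κ,κ) ≤ (5/2) Ā_E`. -/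
theorem pcManti_le_bar : 0 ≤ pcManti B κ κ ∧ pcManti B κ κ ≤ 5 / 2 * pcAEbar B := by
  obtain ⟨hAE0, hAEb⟩ := pcAE_le_bar B hκ0 hκ1 hκD
  unfold pcManti
  refine ⟨by positivity, ?_⟩
  nlinarith

end Bars
/-! ## §2 The conditions (14)–(18), for every `0 ≤ κ ≤ κ_thin(m)` -/

section Conditions

variable (B : BandBounds a b) {m : ℝ} (hm : 0 < m) {κ : ℝ} (hκ0 : 0 ≤ κ) (hκ : κ ≤ pcThinKappa B m)
include hm hκ0 hκ

omit hm hκ0 in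
/-- `κ ≤ 1`, `κ ≤ Dt_min/2`, `κ < Dt_min`, `κ ≤ s`. -/
theorem thin_kappa_basic : κ ≤ 1 ∧ κ ≤ B.Dtmin / 2 ∧ κ < B.Dtmin ∧ κ ≤ pcThinS B m := by
  have hDt := B.Dtmin_pos
  obtain ⟨k1, kD, kS, -⟩ := pcThinKappa_le B m
  exact ⟨hκ.trans k1, by linarith [hκ.trans kD], by linarith [hκ.trans kD], hκ.trans kS⟩

/-- (14) the covering condition `2·C_g·ε₄(κ,κ;λ,η₀F) ≤ τ`. -/
theorem thin_cover_le : 2 * (B.Cg * pcE4 B κ κ (pcThinLam B m) (pcThinF B m)) ≤ pcThinTau B m := by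
  have hDt := B.Dtmin_pos; have hs := B.smax_pos; have hCg := B.Cg_pos
  obtain ⟨k1, kD2, -, -⟩ := thin_kappa_basic B hκ
  obtain ⟨-, -, -, -, -, he4s, -⟩ := pcbar_pos B
  have hT0 := (pcThinTau_pos B hm).le
  have hE4 := pcE4_le_affine B hκ0 k1 kD2 (pcThinLam B m) (pcThinF B m)
  obtain ⟨-, hL2, -⟩ := pcThinLam_le B m
  obtain ⟨-, hF2, -, -⟩ := pcThinF_le B m
  obtain ⟨-, -, -, kT, -⟩ := pcThinKappa_le B m
  have h1 : pcThinLam B m * (4 * B.Cg) ≤ pcThinTau B m := (le_div_iff₀ (by positivity)).mp hL2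
  have h2 : pcThinF B m * (16 * B.Cg * B.smax) ≤ pcThinTau B m * B.Dtmin := (le_div_iff₀ (by positivity)).mp hF2
  have h3 : κ * (8 * B.Cg * pcE4slope B) ≤ pcThinTau B m := (le_div_iff₀ (by positivity)).mp (hκ.trans kT)
  have h2' : 4 * B.Cg * B.smax * (pcThinF B m / B.Dtmin) ≤ pcThinTau B m / 4 := by
    rw [show 4 * B.Cg * B.smax * (pcThinF B m / B.Dtmin) = (4 * B.Cg * B.smax * pcThinF B m) / B.Dtmin by ring, div_le_iff₀ hDt]
    nlinarith
  have hmain : 2 * (B.Cg * pcE4 B κ κ (pcThinLam B m) (pcThinF B m)) ≤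
      2 * (B.Cg * (pcThinLam B m / 2 + 2 * B.smax * (pcThinF B m / B.Dtmin) + κ * pcE4slope B)) :=
    mul_le_mul_of_nonneg_left (mul_le_mul_of_nonneg_left hE4 hCg.le) (by norm_num)
  have hexp : 2 * (B.Cg * (pcThinLam B m / 2 + 2 * B.smax * (pcThinF B m / B.Dtmin) + κ * pcE4slope B)) =
      pcThinLam B m * (4 * B.Cg) / 4 + 4 * B.Cg * B.smax * (pcThinF B m / B.Dtmin) + κ * (8 * B.Cg * pcE4slope B) / 4 := by ring
  linarith

/-- (15) the Cooper-range condition `pcOdd(κ,κ,κ;2λ,η₀F,τ) ≤ h/2`. -/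
theorem thin_odd_le : pcOdd B κ κ κ (2 * pcThinLam B m) (pcThinF B m) (pcThinTau B m) ≤ B.hmin / 2 := by
  have hDt := B.Dtmin_pos; have hs := B.smax_pos; have hCg := B.Cg_pos; have hh := B.hmin_pos
  obtain ⟨k1, kD2, -, -⟩ := thin_kappa_basic B hκ
  obtain ⟨-, -, -, -, hAEb, -, hodd, -⟩ := pcbar_pos B
  have hT0 := (pcThinTau_pos B hm).le; have hL0 := (pcThinLam_pos B hm).le; have hF0 := (pcThinF_pos B hm).le
  have haff := pcOdd_le_affine B hκ0 k1 kD2 (L := 2 * pcThinLam B m) (η₀ := pcThinF B m) (τ := pcThinTau B m) (by positivity) hF0 hT0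
  obtain ⟨-, -, hL3⟩ := pcThinLam_le B m
  obtain ⟨-, -, hF3, hF4⟩ := pcThinF_le B m
  obtain ⟨-, hT2, -⟩ := pcThinTau_le B m
  obtain ⟨-, -, -, -, kO, -⟩ := pcThinKappa_le B m
  have h1 : pcThinLam B m * (24 * pcAEbar B * B.smax * B.Cg) ≤ B.hmin := (le_div_iff₀ (by positivity)).mp hL3
  have h2 : pcThinF B m * (24 * pcAEbar B) ≤ B.hmin * B.Dtmin := (le_div_iff₀ (by positivity)).mp hF3
  have h3 : pcThinF B m * (48 * pcAEbar B * B.smax ^ 2 * B.Cg) ≤ B.hmin * B.Dtmin := (le_div_iff₀ (by positivity)).mp hF4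
  have h4 : pcThinTau B m * (20 * pcAEbar B * B.smax) ≤ B.hmin := (le_div_iff₀ (by positivity)).mp hT2
  have h5 : κ * (10 * pcOddSlope B) ≤ B.hmin := (le_div_iff₀ (by positivity)).mp (hκ.trans kO)
  -- the explicit part, term by term
  have e1 : 2 * pcAEbar B * (pcThinF B m / B.Dtmin) ≤ B.hmin / 12 := by
    rw [show 2 * pcAEbar B * (pcThinF B m / B.Dtmin) = (2 * pcAEbar B * pcThinF B m) / B.Dtmin by ring, div_le_iff₀ hDt]; nlinarith
  have e2 : 2 * pcAEbar B * (B.smax * (B.Cg * (2 * pcThinLam B m / 2))) ≤ B.hmin / 12 := by nlinarith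
  have e3 : 2 * pcAEbar B * (B.smax * (B.Cg * (2 * B.smax * (pcThinF B m / B.Dtmin)))) ≤ B.hmin / 12 := by
    rw [show 2 * pcAEbar B * (B.smax * (B.Cg * (2 * B.smax * (pcThinF B m / B.Dtmin)))) =
      (4 * pcAEbar B * B.smax ^ 2 * B.Cg * pcThinF B m) / B.Dtmin by ring, div_le_iff₀ hDt]; nlinarith
  have e4 : 2 * pcAEbar B * (B.smax * pcThinTau B m) ≤ B.hmin / 10 := by nlinarith
  have hexp : 2 * pcAEbar B * (pcThinF B m / B.Dtmin + B.smax * (B.Cg * (2 * pcThinLam B m / 2 + 2 * B.smax * (pcThinF B m / B.Dtmin)) +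
      pcThinTau B m)) = 2 * pcAEbar B * (pcThinF B m / B.Dtmin) + 2 * pcAEbar B * (B.smax * (B.Cg * (2 * pcThinLam B m / 2))) +
        2 * pcAEbar B * (B.smax * (B.Cg * (2 * B.smax * (pcThinF B m / B.Dtmin)))) + 2 * pcAEbar B * (B.smax * pcThinTau B m) := by ring
  linarith

omit hm in
/-- (16) `κ·A_E(κ,κ) ≤ h/2`. -/
theorem thin_kAE_le : κ * pcAE B κ κ ≤ B.hmin / 2 := by
  have hDt := B.Dtmin_pos
  obtain ⟨k1, kD2, -, -⟩ := thin_kappa_basic B hκ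
  obtain ⟨hAE0, hAEb⟩ := pcAE_le_bar B hκ0 k1 kD2
  obtain ⟨-, -, -, -, hAEbar0, -⟩ := pcbar_pos B
  obtain ⟨-, -, -, -, -, kA, -⟩ := pcThinKappa_le B m
  have h1 : κ * (2 * pcAEbar B) ≤ B.hmin := (le_div_iff₀ (by positivity)).mp (hκ.trans kA)
  nlinarith [mul_le_mul_of_nonneg_left hAEb hκ0]

/-- (17) the fold condition `pcEven(κ,κ,κ;λ,η₀F,τ) ≤ h/2`. -/
theorem thin_even_le : pcEven B κ κ κ (pcThinLam B m) (pcThinF B m) (pcThinTau B m) ≤ B.hmin / 2 := by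
  have hDt := B.Dtmin_pos; have hs := B.smax_pos; have hCg := B.Cg_pos; have hh := B.hmin_pos
  obtain ⟨k1, kD2, -, -⟩ := thin_kappa_basic B hκ
  obtain ⟨-, -, -, -, hAEb, -, -, heven, -⟩ := pcbar_pos B
  have hT0 := (pcThinTau_pos B hm).le; have hL0 := (pcThinLam_pos B hm).le; have hF0 := (pcThinF_pos B hm).le
  have haff := pcEven_le_affine B hκ0 k1 kD2 (lam := pcThinLam B m) (η₀ := pcThinF B m) (τ := pcThinTau B m) hL0 hF0 hT0
  obtain ⟨-, -, hL3⟩ := pcThinLam_le B m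
  obtain ⟨-, -, hF3, hF4⟩ := pcThinF_le B m
  obtain ⟨-, hT2, hT3, -⟩ := pcThinTau_le B m
  obtain ⟨-, -, -, -, -, -, kE, -⟩ := pcThinKappa_le B m
  have h1 : pcThinLam B m * (24 * pcAEbar B * B.smax * B.Cg) ≤ B.hmin := (le_div_iff₀ (by positivity)).mp hL3
  have h2 : pcThinF B m * (24 * pcAEbar B) ≤ B.hmin * B.Dtmin := (le_div_iff₀ (by positivity)).mp hF3
  have h3 : pcThinF B m * (48 * pcAEbar B * B.smax ^ 2 * B.Cg) ≤ B.hmin * B.Dtmin := (le_div_iff₀ (by positivity)).mp hF4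
  have h4 : pcThinTau B m * (20 * pcAEbar B * B.smax) ≤ B.hmin := (le_div_iff₀ (by positivity)).mp hT2
  have h5 : pcThinTau B m * (30 * pcAEbar B ^ 2 * B.smax * B.Cg) ≤ B.hmin := (le_div_iff₀ (by positivity)).mp hT3
  have h6 : κ * (12 * pcEvenSlope B) ≤ B.hmin := (le_div_iff₀ (by positivity)).mp (hκ.trans kE)
  have e1 : 2 * pcAEbar B * (pcThinF B m / B.Dtmin) ≤ B.hmin / 12 := by
    rw [show 2 * pcAEbar B * (pcThinF B m / B.Dtmin) = (2 * pcAEbar B * pcThinF B m) / B.Dtmin by ring, div_le_iff₀ hDt]; nlinarith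
  have e2 : 2 * pcAEbar B * (B.smax * (B.Cg * pcThinLam B m)) ≤ B.hmin / 12 := by nlinarith
  have e3 : 2 * pcAEbar B * (B.smax * (B.Cg * (5 / 4 * pcAEbar B * pcThinTau B m))) ≤ B.hmin / 12 := by nlinarith
  have e4 : 2 * pcAEbar B * (B.smax * (B.Cg * (2 * B.smax * (pcThinF B m / B.Dtmin)))) ≤ B.hmin / 12 := by
    rw [show 2 * pcAEbar B * (B.smax * (B.Cg * (2 * B.smax * (pcThinF B m / B.Dtmin)))) =
      (4 * pcAEbar B * B.smax ^ 2 * B.Cg * pcThinF B m) / B.Dtmin by ring, div_le_iff₀ hDt]; nlinarith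
  have e5 : 2 * pcAEbar B * (B.smax * (pcThinTau B m / 2)) ≤ B.hmin / 20 := by nlinarith
  have hexp : 2 * pcAEbar B * (pcThinF B m / B.Dtmin + B.smax * (B.Cg * (pcThinLam B m + 5 / 4 * pcAEbar B * pcThinTau B m +
      2 * B.smax * (pcThinF B m / B.Dtmin)) + pcThinTau B m / 2)) =
      2 * pcAEbar B * (pcThinF B m / B.Dtmin) + 2 * pcAEbar B * (B.smax * (B.Cg * pcThinLam B m)) +
        2 * pcAEbar B * (B.smax * (B.Cg * (5 / 4 * pcAEbar B * pcThinTau B m))) +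
        2 * pcAEbar B * (B.smax * (B.Cg * (2 * B.smax * (pcThinF B m / B.Dtmin)))) + 2 * pcAEbar B * (B.smax * (pcThinTau B m / 2)) := by ring
  linarith

/-- (18) the diagonal-stratum condition `pcDiag(κ,κ,κ;s,s) ≤ 2h`. -/
theorem thin_diag_le : pcDiag B κ κ κ (pcThinS B m) (pcThinS B m) ≤ 2 * B.hmin := by
  have hDt := B.Dtmin_pos; have hs := B.smax_pos; have hCg := B.Cg_pos; have hh := B.hmin_pos
  obtain ⟨k1, kD2, -, -⟩ := thin_kappa_basic B hκ
  obtain ⟨-, hSEb, -, -, hAEb, -, -, -, hdiag⟩ := pcbar_pos B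
  obtain ⟨-, -, hDA, -⟩ := pcThin_slopes_pos B
  have hS0 := (pcThinS_pos B hm).le
  have haff := pcDiag_le_affine B hκ0 k1 kD2 (η₀ := pcThinS B m) (η₁ := pcThinS B m) hS0 hS0
  obtain ⟨-, -, hS3⟩ := pcThinS_le B m
  obtain ⟨-, -, -, -, -, -, -, kDg, -⟩ := pcThinKappa_le B m
  have h1 : pcThinS B m * pcThinDA B ≤ B.hmin := (le_div_iff₀ hDA).mp hS3
  have h2 : κ * pcDiagSlope B ≤ B.hmin := (le_div_iff₀ hdiag).mp (hκ.trans kDg)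
  have hexp : (16 * pcSEbar B ^ 2 + 8 * pcAEbar B) * (pcThinS B m / B.Dtmin + B.smax * (B.Cg * (pcThinS B m / 4 + 2 * B.smax * (pcThinS B m / B.Dtmin)))) =
      pcThinS B m * pcThinDA B := by unfold pcThinDA; ring
  linarith

end Conditions

end Summit.HubbardSuperconductivity.HubbardSuperconductivity.Theorems.PerturbedFermiCurve

end
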